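import Mathlib
import HarnessLib
import Summits.HubbardSuperconductivity.HubbardSuperconductivity.Theorems.KLProgrammeKLRegimeEngineTowerLipschitz

/-!
# Route `KLProgramme` — crux K3 ENGINE (stmt-HubbardSuperconductivity-20437 `KLRegimeEngineV17F2`), stub (e) proof-input «(e)-D-ROWS»: THE DIFFERENCE BRIDGE OF THE
# PROFILE-FORM LIPSCHITZ TOWER FROM A RE-MEASUREMENT ROW WITH SOURCES
# (seat hubbard-kl-k3c4-p1 g24, VL lane; supplier of `hprofd` / `hprofd3` of `…EngineTowerLipschitzProfileTok.towerBornDiff_le_law_of_profile_tok`; DROWS-SCOPE-g24 v9 §11.2 (A))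

`towerBornDiff_le_law_of_profile_tok` takes the DIFFERENCE BRIDGE as a hypothesis: from the relative law `db k′ p ≤ R k′·Aλ^{p−1}Q^p` on the born differences of the
blocks `2 ≤ k′ ≤ k`, the relative profile `dμ k m ≤ R k·A′λ^{m−1}Q′^m` of the measured difference of block `k`.  The two-volume re-measurement row
(`…TwoVolumeLipBaseRemeasure.klLipInputDiffSup_le_remeasured_of_base`, in units) has the shape of the one-volume row PLUS SOURCES:
`dμ k m ≤ Σ_{k′≤k} c₁c₂^m g^{(m−2)(k+1−k′)} db k′ m + sμ k m` (the transferred born differences of the earlier blocks, and the far tails / base tails `sμ`).  This file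
turns that row into the bridge, exactly as T3-Lip₄ did internally (`towerMeasured_le_profile`, `towerMeasured_three_le`), with the sources charged to the budget:
if `sμ k m ≤ R k·ΔA·λ^{m−1}(c₂gQ)^m` then `A′ := c₁A/((1−g)g²) + ΔA`, `Q′ := c₂gQ` (degrees `2m ≥ 8`), and `ι₃ := c₁c₂³AQ³g₃/(1−g₃) + Δ₃` at six legs.

* **`hprofd_of_remeasured`**, **`hprofd3_of_remeasured`** — the two bridge hypotheses of `towerBornDiff_le_law_of_profile_tok` from the row with sources
  (re-based: no born arrays below block `2`, `db k′ = 0` for `k′ < 2`; budget `0 ≤ R 1`, `R k + s k ≤ R (k+1)`, `0 ≤ s`).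

Pure real analysis; nothing about the model is asserted; nothing asserts the (D) rows, stub (e), VL, K3 or superconductivity.
References: BGM 2006 §2.8 (2.93)–(2.98), §3 [cite: BenfattoGiulianiMastropietro2006].
-/

noncomputable section

namespace Summit.HubbardSuperconductivity.HubbardSuperconductivity.Theorems.EngineV8

set_option linter.dupNamespace false -- summit = problem name (single-conjunct summit), D-0017

open Real Finset

/-- **The difference bridge in degrees `2m ≥ 8` from the re-measurement row with sources.**  Constants `A, λ, Q ≥ 0`, `0 < g < 1`, `c₁, c₂ ≥ 0`, any `ΔA`; born differences
`db ≥ 0` vanishing below block `2`; budget `0 ≤ R 1`, `R k + s k ≤ R (k+1)`, `0 ≤ s`; the row `dμ k m ≤ Σ_{k′≤k} c₁c₂^m g^{(m−2)(k+1−k′)} db k′ m + sμ k m` with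
`sμ k m ≤ R k·ΔA·λ^{m−1}(c₂gQ)^m` (`3 ≤ m ≤ D`, `1 ≤ k < K`).  Then the `hprofd` hypothesis of `towerBornDiff_le_law_of_profile_tok` holds with
`A′ = c₁A/((1−g)g²) + ΔA`, `Q′ = c₂gQ`. -/
theorem hprofd_of_remeasured {D K : ℕ} {db dμ sμ : ℕ → ℕ → ℝ} {R s : ℕ → ℝ} {A lam Q g c₁ c₂ ΔA : ℝ}
    (hA : 0 ≤ A) (hlam : 0 ≤ lam) (hQ : 0 ≤ Q) (hg0 : 0 < g) (hg1 : g < 1) (hc₁ : 0 ≤ c₁) (hc₂ : 0 ≤ c₂)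
    (hdb0 : ∀ k m, 0 ≤ db k m) (hdblow : ∀ k', k' < 2 → ∀ m, db k' m = 0)
    (hs0 : ∀ k, 0 ≤ s k) (hR1 : 0 ≤ R 1) (hR : ∀ k, R k + s k ≤ R (k + 1))
    (hrow : ∀ k, 1 ≤ k → k < K → ∀ m, 3 ≤ m → m ≤ D →
      dμ k m ≤ (∑ k' ∈ range (k + 1), c₁ * c₂ ^ m * g ^ ((m - 2) * (k + 1 - k')) * db k' m) + sμ k m)
    (hsμ : ∀ k, 1 ≤ k → k < K → ∀ m, 3 ≤ m → m ≤ D → sμ k m ≤ R k * (ΔA * lam ^ (m - 1) * (c₂ * g * Q) ^ m)) :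
    ∀ k, 1 ≤ k → k < K →
      (∀ k', 2 ≤ k' → k' ≤ k → ∀ p, 3 ≤ p → p ≤ D → db k' p ≤ R k' * (A * lam ^ (p - 1) * Q ^ p)) →
      ∀ m, 4 ≤ m → m ≤ D → dμ k m ≤ R k * ((c₁ * A / ((1 - g) * g ^ 2) + ΔA) * lam ^ (m - 1) * (c₂ * g * Q) ^ m) := by
  intro k hk1 hkK hlaw m hm hmD
  have hRmono : ∀ {k' k''}, k' ≤ k'' → R k' ≤ R k'' := fun h => budget_mono hs0 hR h
  have hRk : 0 ≤ R k := hR1.trans (hRmono hk1)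
  -- the born differences of the blocks `≤ k` are below the law with the CURRENT budget `R k`
  have hborn : ∀ k' ≤ k, ∀ m', 3 ≤ m' → m' ≤ D → db k' m' ≤ (R k * A) * lam ^ (m' - 1) * Q ^ m' := by
    intro k' hk' m' hm' hm'D
    rcases Nat.lt_or_ge k' 2 with hlt | hge
    · rw [hdblow k' hlt m']; positivity
    · calc db k' m' ≤ R k' * (A * lam ^ (m' - 1) * Q ^ m') := hlaw k' hge hk' m' hm' hm'D
        _ ≤ R k * (A * lam ^ (m' - 1) * Q ^ m') := mul_le_mul_of_nonneg_right (hRmono hk') (by positivity)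
        _ = _ := by ring
  have hT1 := towerMeasured_le_profile (D := D) (μ := fun k m => ∑ k' ∈ range (k + 1), c₁ * c₂ ^ m * g ^ ((m - 2) * (k + 1 - k')) * db k' m)
    (mul_nonneg hRk hA) hlam hQ hg0 hg1 hc₁ hc₂ hdb0 (k := k) (fun m _ _ => le_rfl) hborn (by omega : 3 ≤ m) hmD
  have hsrc := hsμ k hk1 hkK m (by omega) hmD
  calc dμ k m ≤ (∑ k' ∈ range (k + 1), c₁ * c₂ ^ m * g ^ ((m - 2) * (k + 1 - k')) * db k' m) + sμ k m := hrow k hk1 hkK m (by omega) hmD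
    _ ≤ c₁ * (R k * A) / ((1 - g) * g ^ 2) * lam ^ (m - 1) * (c₂ * g * Q) ^ m + R k * (ΔA * lam ^ (m - 1) * (c₂ * g * Q) ^ m) := add_le_add hT1 hsrc
    _ = R k * ((c₁ * A / ((1 - g) * g ^ 2) + ΔA) * lam ^ (m - 1) * (c₂ * g * Q) ^ m) := by ring

/-- **The difference bridge at six legs from the re-measurement row with sources** (ratio `0 ≤ g₃ < 1`): the `hprofd3` hypothesis of
`towerBornDiff_le_law_of_profile_tok` with `ι₃ := c₁c₂³AQ³·g₃/(1−g₃) + Δ₃`. -/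
theorem hprofd3_of_remeasured {D K : ℕ} {db dμ sμ : ℕ → ℕ → ℝ} {R s : ℕ → ℝ} {A lam Q g₃ c₁ c₂ Δ₃ : ℝ}
    (hA : 0 ≤ A) (hlam : 0 ≤ lam) (hQ : 0 ≤ Q) (hg0 : 0 ≤ g₃) (hg1 : g₃ < 1) (hc₁ : 0 ≤ c₁) (hc₂ : 0 ≤ c₂)
    (hdb0 : ∀ k m, 0 ≤ db k m) (hdblow : ∀ k', k' < 2 → ∀ m, db k' m = 0)
    (hs0 : ∀ k, 0 ≤ s k) (hR1 : 0 ≤ R 1) (hR : ∀ k, R k + s k ≤ R (k + 1))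
    (hrow : ∀ k, 1 ≤ k → k < K → dμ k 3 ≤ (∑ k' ∈ range (k + 1), c₁ * c₂ ^ 3 * g₃ ^ (k + 1 - k') * db k' 3) + sμ k 3)
    (hsμ : ∀ k, 1 ≤ k → k < K → sμ k 3 ≤ R k * (Δ₃ * lam ^ 2)) :
    ∀ k, 1 ≤ k → k < K → 3 ≤ D →
      (∀ k', 2 ≤ k' → k' ≤ k → ∀ p, 3 ≤ p → p ≤ D → db k' p ≤ R k' * (A * lam ^ (p - 1) * Q ^ p)) →
      dμ k 3 ≤ R k * ((c₁ * c₂ ^ 3 * A * Q ^ 3 * (g₃ / (1 - g₃)) + Δ₃) * lam ^ 2) := by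
  intro k hk1 hkK hD3 hlaw
  have hRmono : ∀ {k' k''}, k' ≤ k'' → R k' ≤ R k'' := fun h => budget_mono hs0 hR h
  have hRk : 0 ≤ R k := hR1.trans (hRmono hk1)
  have hborn : ∀ k' ≤ k, db k' 3 ≤ (R k * A) * lam ^ 2 * Q ^ 3 := by
    intro k' hk'
    rcases Nat.lt_or_ge k' 2 with hlt | hge
    · rw [hdblow k' hlt 3]; positivity
    · calc db k' 3 ≤ R k' * (A * lam ^ (3 - 1) * Q ^ 3) := hlaw k' hge hk' 3 le_rfl hD3
        _ ≤ R k * (A * lam ^ (3 - 1) * Q ^ 3) := mul_le_mul_of_nonneg_right (hRmono hk') (by positivity)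
        _ = _ := by norm_num; ring
  have hT1 := towerMeasured_three_le (μ := fun k (_ : ℕ) => ∑ k' ∈ range (k + 1), c₁ * c₂ ^ 3 * g₃ ^ (k + 1 - k') * db k' 3)
    (mul_nonneg hRk hA) hQ hg0 hg1 hc₁ hc₂ hdb0 (k := k) le_rfl hborn
  have hsrc := hsμ k hk1 hkK
  calc dμ k 3 ≤ (∑ k' ∈ range (k + 1), c₁ * c₂ ^ 3 * g₃ ^ (k + 1 - k') * db k' 3) + sμ k 3 := hrow k hk1 hkK
    _ ≤ c₁ * c₂ ^ 3 * (R k * A) * Q ^ 3 * (g₃ / (1 - g₃)) * lam ^ 2 + R k * (Δ₃ * lam ^ 2) := add_le_add hT1 hsrc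
    _ = R k * ((c₁ * c₂ ^ 3 * A * Q ^ 3 * (g₃ / (1 - g₃)) + Δ₃) * lam ^ 2) := by ring

end Summit.HubbardSuperconductivity.HubbardSuperconductivity.Theorems.EngineV8

end
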